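import Summits.HodgeConjecture.HodgeConjecture.Cruxes.BlochSeedDiscOne.PortHallLegSurplus

/-!
line stmt-HodgeConjecture-18881 Cruxes/BlochSeedDiscOne/Lines/birth.lean 814a6a70c14e831a stub_rung_pad4_seedAt

# LegFreeRuleD — RULE D has no leg-free models: on a LEG-FREE design (`PortHallLeg.EntrySharp`) RULE D (`LeggedFloor.RuleD`) forces every
# supported cell to be a diagonal hub; with the SCOPE rows (`OnAlphabet h ∧ Disj`) one side of the design is EMPTY
(planner `plan-lens-HodgeAV-negation` g26, 2026-08-31; third typed piece of ROW-α2; memo `PORTHALL8-ROW-A2-negation-g26.md` §5 (E).)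

WHY (three lines).  A supplier pair `Supplies x y g j` is EQUAL off `{g, j}` — two factors at least — so it is weakly live and NEVER four-ample
(`not_live_of_supplies`); `EntrySharp` says every weakly-live (P-entry, N-entry) pair IS four-ample; hence under `EntrySharp` no supported cell can
have a supplier, RULE D then forbids every supported cell to DETECT any block, and a cell detecting no block is `(a;0,0)⁴` for one level `a`
(`diagonalHub_of_forall_not_detects`); on the height-`h` alphabet that is `hub⁴`, and `Disj` lets at most one side contain it.

CONSEQUENCE FOR v42 (director-hodge R19.846 (i)+(ii): `ScopeRows` gains `EntrySharp`, `ShadowRows` keeps `RuleD`): the scoped sieve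
«`ScopeRows h ∧ EntrySharp` ⟹ `ShadowRows`» has NO design with both a supported P-cell and a supported N-cell to talk about
(`suppP_eq_nil_or_suppN_eq_nil`): for the LEG-FREE split-block ansatz, the RULE D row ALONE is the whole kill — either RULE D is a theorem for
split-block seeds (then leg-free split blocks carry no seed, at every height, with no Hall ∕ budget ∕ μ row needed), or RULE D is a legged-world row
that must not be imposed on leg-free blocks.  Which of the two holds is a question about RULE D's law (memo-152 ∕ its pen derivation), not settled here.

STATUS ∕ SCOPE.  Letter-model statements about `DepthBoundA4.Design`; NOTHING here is proved toward HC ∕ HC_CM ∕ HC_AV ∕ №4 ∕ 26512 ∕ 18881 ∕ H2; no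
stub of any skeleton is registered or touched.  Imports the BUILT module `PortHallLegSurplus` only; no `axiom`, no `instance`, no notation, no `sorry`,
no `native_decide`.
-/

set_option linter.dupNamespace false
set_option autoImplicit false

namespace Summit.HodgeConjecture.HodgeConjecture.Cruxes.BlochSeedDiscOne.PortHallLeg

open Summit.HodgeConjecture.HodgeConjecture.Cruxes.BlochSeedDiscOne.DepthBoundA4
open Summit.HodgeConjecture.HodgeConjecture.Cruxes.BlochSeedDiscOne.LeggedFloor
open Summit.HodgeConjecture.HodgeConjecture.Cruxes.BlochSeedDiscOne.HallB136
open Summit.HodgeConjecture.HodgeConjecture.Cruxes.BlochSeedDiscOne.RuleDPlate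

/-! ## §1 Supplier pairs are legged -/

theorem exists_ne_ne (g j : Fin 4) : ∃ f : Fin 4, f ≠ g ∧ f ≠ j := by
  revert g j
  decide

/-- a supplier pair is weakly live … -/
theorem weakLive_of_supplies {x y : Cell} {g j : Fin 4} (h : Supplies x y g j) : WeakLive x y := by
  obtain ⟨hoff, hg, hj⟩ := h
  intro f
  by_cases hfg : f = g
  · subst hfg
    rcases hg with he | hn
    · exact Or.inl he
    · exact Or.inr ⟨hn.1, le_of_eq hn.2⟩
  · by_cases hfj : f = j
    · subst hfj
      rcases hj with he | hn
      · exact Or.inl he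
      · exact Or.inr ⟨hn.1, le_of_eq hn.2⟩
    · exact Or.inl (hoff f hfg hfj)

/-- … and never four-ample (it is EQUAL on at least two factors). -/
theorem not_live_of_supplies {x y : Cell} {g j : Fin 4} (h : Supplies x y g j) : ¬ Live x y := by
  intro hl
  obtain ⟨f, hfg, hfj⟩ := exists_ne_ne g j
  have he : x f = y f := h.1 f hfg hfj
  have ha := (hl f).1
  rw [he] at ha
  exact lt_irrefl _ ha

/-! ## §2 Under `EntrySharp`, RULE D forbids detection -/

theorem exists_entry_of_mem_suppP {E : Design} {x : Cell} (hx : x ∈ E.suppP) : ∃ m : ℕ, 0 < m ∧ (x, m) ∈ E.P := by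
  simp only [Design.suppP, List.mem_map, List.mem_filter, decide_eq_true_eq] at hx
  obtain ⟨⟨c, m⟩, ⟨hmem, hpos⟩, rfl⟩ := hx
  exact ⟨m, hpos, hmem⟩

theorem exists_entry_of_mem_suppN {E : Design} {y : Cell} (hy : y ∈ E.suppN) : ∃ n : ℕ, 0 < n ∧ (y, n) ∈ E.N := by
  simp only [Design.suppN, List.mem_map, List.mem_filter, decide_eq_true_eq] at hy
  obtain ⟨⟨c, n⟩, ⟨hmem, hpos⟩, rfl⟩ := hy
  exact ⟨n, hpos, hmem⟩

/-- on a leg-free design no supported P-cell has a supplier among the supported N-cells, and vice versa. -/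
theorem not_supplies_of_entrySharp {E : Design} (hE : EntrySharp E) {x y : Cell} (hx : x ∈ E.suppP) (hy : y ∈ E.suppN)
    (g j : Fin 4) : ¬ Supplies x y g j := by
  intro hs
  obtain ⟨m, _, hxm⟩ := exists_entry_of_mem_suppP hx
  obtain ⟨n, _, hyn⟩ := exists_entry_of_mem_suppN hy
  exact not_live_of_supplies hs (hE (x, m) hxm (y, n) hyn (weakLive_of_supplies hs))

/-- **under `EntrySharp`, RULE D says: no supported cell detects any block.** -/
theorem forall_not_detects_of_entrySharp_of_ruleD {E : Design} (hE : EntrySharp E) (hD : RuleD E) :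
    (∀ x ∈ E.suppP, ∀ g j : Fin 4, g < j → ¬ Detects x g j) ∧ (∀ y ∈ E.suppN, ∀ g j : Fin 4, g < j → ¬ Detects y g j) := by
  refine ⟨fun x hx g j hgj hdet => ?_, fun y hy g j hgj hdet => ?_⟩
  · obtain ⟨y, hy, hs⟩ := hD.2 x hx g j hgj hdet
    exact not_supplies_of_entrySharp hE hx hy g j hs
  · obtain ⟨x, hx, hs⟩ := hD.1 y hy g j hgj hdet
    exact not_supplies_of_entrySharp hE hx hy g j hs

/-! ## §3 A cell detecting no block is a diagonal hub -/

/-- all four letters axis-free with one common level. -/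
def IsDiagonalHub (c : Cell) : Prop := ∀ f : Fin 4, (c f).x = 0 ∧ (c f).y = 0 ∧ (c f).a = (c 0).a

theorem diagonalHub_of_forall_not_detects {c : Cell} (h : ∀ g j : Fin 4, g < j → ¬ Detects c g j) : IsDiagonalHub c := by
  have key : ∀ j : Fin 4, 0 < j → (c 0).x = 0 ∧ (c 0).y = 0 ∧ (c j).x = 0 ∧ (c j).y = 0 ∧ (c 0).a = (c j).a :=
    fun j hj => not_not.mp (h 0 j hj)
  intro f
  by_cases hf : f = 0
  · subst hf
    have h1 := key 1 (by decide)
    exact ⟨h1.1, h1.2.1, rfl⟩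
  · have hpos : 0 < f := by
      rcases Fin.eq_zero_or_eq_succ f with h0 | ⟨k, hk⟩
      · exact absurd h0 hf
      · exact Fin.pos_iff_ne_zero.2 hf
    have hk := key f hpos
    exact ⟨hk.2.2.1, hk.2.2.2.1, hk.2.2.2.2.symm⟩

/-- a diagonal hub on the height-`h` alphabet is `hub⁴`. -/
theorem eq_hub_of_diagonalHub {c : Cell} {h : ℤ} (hd : IsDiagonalHub c) (ha : ∀ f : Fin 4, (c f).OnAlphabet h) :
    c = fun _ => Letter.hub h := by
  funext f
  obtain ⟨hx, hy, _⟩ := hd f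
  obtain ⟨hh, _⟩ := ha f
  unfold Letter.height at hh
  rw [hx, hy] at hh
  simp only [abs_zero, add_zero] at hh
  cases hc : c f with
  | mk a x y =>
    simp only [hc] at hx hy hh
    subst hx hy hh
    rfl

/-! ## §4 The collapse -/

/-- **LEG-FREE + RULE D + ALPHABET ⟹ every supported cell is `hub⁴`.** -/
theorem supported_eq_hub_of_entrySharp_of_ruleD {E : Design} {h : ℤ} (hA : E.OnAlphabet h) (hE : EntrySharp E) (hD : RuleD E) :
    (∀ x ∈ E.suppP, x = fun _ => Letter.hub h) ∧ (∀ y ∈ E.suppN, y = fun _ => Letter.hub h) := by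
  obtain ⟨hP, hN⟩ := forall_not_detects_of_entrySharp_of_ruleD hE hD
  refine ⟨fun x hx => ?_, fun y hy => ?_⟩
  · exact eq_hub_of_diagonalHub (diagonalHub_of_forall_not_detects (hP x hx)) fun f => hA x (List.mem_append_right _ hx) f
  · exact eq_hub_of_diagonalHub (diagonalHub_of_forall_not_detects (hN y hy)) fun f => hA y (List.mem_append_left _ hy) f

/-- **… and with `Disj` one side is EMPTY**: the scoped leg-free sieve of v42 (`OnAlphabet h ∧ Disj ∧ EntrySharp` with `RuleD` among the rows)
has no design with a supported P-cell and a supported N-cell. -/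
theorem suppP_eq_nil_or_suppN_eq_nil {E : Design} {h : ℤ} (hA : E.OnAlphabet h) (hdisj : Disj E) (hE : EntrySharp E) (hD : RuleD E) :
    E.suppP = [] ∨ E.suppN = [] := by
  obtain ⟨hP, hN⟩ := supported_eq_hub_of_entrySharp_of_ruleD hA hE hD
  by_contra hne
  have hne' : E.suppP ≠ [] ∧ E.suppN ≠ [] := not_or.mp hne
  obtain ⟨x, hx⟩ := List.exists_mem_of_ne_nil E.suppP hne'.1
  obtain ⟨y, hy⟩ := List.exists_mem_of_ne_nil E.suppN hne'.2
  have hxy : x = y := by rw [hP x hx, hN y hy]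
  subst hxy
  exact hdisj x hy hx

/-- **an in-scope leg-free design with a supported P-cell and a supported N-cell violates RULE D** (e.g. `PortHallStarRow`'s `D3`; the legged
`C1`, `C2` are where RULE D can hold) — RULE D is a row of the legged world. -/
theorem not_ruleD_of_entrySharp {E : Design} {h : ℤ} (hA : E.OnAlphabet h) (hdisj : Disj E) (hE : EntrySharp E)
    (hP : E.suppP ≠ []) (hN : E.suppN ≠ []) : ¬ RuleD E :=
  fun hD => by
    rcases suppP_eq_nil_or_suppN_eq_nil hA hdisj hE hD with h0 | h0
    · exact hP h0
    · exact hN h0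

/-! ## Audit: nothing is decided here

Every theorem is an implication between letter-model rows.  Whether RULE D is a law for split-block seeds is not touched; the file only shows
that RULE D and leg-freeness are jointly satisfiable on the scope rows by one-sided (all-`hub⁴`) designs alone. -/

end Summit.HodgeConjecture.HodgeConjecture.Cruxes.BlochSeedDiscOne.PortHallLeg
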